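/-
COR-CM (cell pub-hodgecm2, stage 2 of the Hodge ladder) — count-neutral KERNEL COMBINATORICS «dicyclic twist, even order: reducing faces killed by the
strict-half functionals, I (tools, strict squares, mixed squares)» (seat prover-pub-hodgecm2-b23-g43-0, binder prover b23, gen 43; claim DICYCLIC-EVEN,
HOME/INBOX.md l.10881; blanket `Census/DicyclicTwist*`).  Theorems only, on top of `Census/DicyclicTwistEvenMotion.lean`; no `decide` beyond closed
identities in `ZMod 2`, no certificate, no named fact, no `sorry`.  `Interfaces.lean` (C1), every E term, B01, `Transposition/*`, `PortJoin/*` untouched.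
HONEST FRAMING: `HC_CM` is NOT proved, here or anywhere in the tree; nothing here is a period, a count of record or a headline.
T5: n/a-class (no hypothesis binders beyond the model's data); checker: self, 2026-08-23.
-/
import Summits.HodgeConjecture.CorCM.Census.DicyclicTwistEvenMotion

/-!
# The dicyclic twist `Dic(ℤ/2 × A)`, `|A|` even, III: reducing faces killed by the functionals — tools, strict squares, mixed squares

A RULE FACE through a non-residual label `Ψ = (φ, ψ)` (potential `cls φ + cls ψ ≥ 2`) is a face of the model which is `1` at `Ψ`, otherwise supported
in smaller potential (so that the descent of part III applies), killed by the `2|A|` functionals `UE s`, `UX s`, and — unless `Ψ` lies on the double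
equator `2·wt φ = 2·wt ψ = |A|` — also by `SE₀`, `SE₁` (`Census/DicyclicTwistEvenFunctionals.lean`).  This file supplies the tools and the two
parity-free shapes; the sequel `Census/DicyclicTwistEvenRule.lean` treats the labels with a coordinate on the equator and assembles the rule.

* §1 Values of a dot-product functional on the three face shapes (`dot_faceVec₀/₁/M`), and the covering property of a face from class inequalities at
  its corners (`cover_faceVec₀`, `cover_faceVecM`).
* §2 THE MIRROR: if `v'` is a rule face through `x⁻¹·Ψ` then `x·v'` is one through `Ψ` (`cover_translX` of gen 42, `killedE_translX`,
  `killedF_translX`; the shapes are exchanged by `translX_faceVec₀/M`).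
* §3 STRICT SQUARES: through `(φ, ψ)` with `cls φ ≥ 2` and `φ` OFF the equator there are two places `i ≠ j` whose single and double flips lower the
  class and stay in the strict half of `φ` (`exists_strict_square`); the `0`-coordinate square there is killed by all four functionals, for EVERY
  passive `ψ` (`killed_faceVec₀_strict`: each weight is, along the square, constant or affine in one defect indicator — gen 42's mechanism with
  strict halves), whence `exists_rule_strict₀`.
* §4 MIXED SQUARES at two labels of class `1` (`exists_rule_mixed₁₁`): the active flips end in constants of the same strict half.
All [folklore].

## References
* [Pohlmann1968] H. Pohlmann, Algebraic cycles on abelian varieties of complex multiplication type, Ann. of Math. 88 (1968), Thm 1.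
-/

namespace Summit.HodgeConjecture.CorCM.Census.DicyclicTwist

open Finset
open Summit.HodgeConjecture.CorCM.Census.OddSliceFacesModel
open Summit.HodgeConjecture.CorCM.Census.OddSliceFacesSquares
open Summit.HodgeConjecture.CorCM.Census.OddSliceFacesDescent
open Summit.HodgeConjecture.CorCM.Census.EvenSliceFacesDescent

variable (A : Type) [AddCommGroup A] [Fintype A] [DecidableEq A]

/-! ## §1 Dot products with faces; covering from class inequalities -/

omit [AddCommGroup A] in
/-- A dot product with a `0`-coordinate face is the sum of the weights of its four corners. [folklore] -/
theorem dot_faceVec₀ (w : Ty₂ A → ℤ) (φ : Ty A) (i j : A) (ψ : Ty A) :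
    w ⬝ᵥ faceVec₀ A φ i j ψ = w (φ, ψ) + w (φ + 1 + δ A i, ψ + 1) + w (φ + 1 + δ A j, ψ + 1) + w (φ + δ A i + δ A j, ψ) := by
  simp only [faceVec₀, dotProduct_add, dotProduct_single, mul_one]

omit [AddCommGroup A] in
/-- A dot product with a `1`-coordinate face. [folklore] -/
theorem dot_faceVec₁ (w : Ty₂ A → ℤ) (ψ φ : Ty A) (i j : A) :
    w ⬝ᵥ faceVec₁ A ψ φ i j = w (ψ, φ) + w (ψ + 1, φ + 1 + δ A i) + w (ψ + 1, φ + 1 + δ A j) + w (ψ, φ + δ A i + δ A j) := by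
  simp only [faceVec₁, dotProduct_add, dotProduct_single, mul_one]

omit [AddCommGroup A] in
/-- A dot product with a mixed face. [folklore] -/
theorem dot_faceVecM (w : Ty₂ A → ℤ) (φ : Ty A) (i : A) (ψ : Ty A) (j : A) :
    w ⬝ᵥ faceVecM A φ i ψ j = w (φ, ψ) + w (φ + 1 + δ A i, ψ + 1) + w (φ + 1, ψ + 1 + δ A j) + w (φ + δ A i, ψ + δ A j) := by
  simp only [faceVecM, dotProduct_add, dotProduct_single, mul_one]

/-- **A `0`-coordinate square whose three flips lower the class covers its label.** [folklore] -/
theorem cover_faceVec₀ {φ : Ty A} {i j : A} (ψ : Ty A) (hi : clsTy A (φ + δ A i) < clsTy A φ) (hj : clsTy A (φ + δ A j) < clsTy A φ)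
    (hij : clsTy A (φ + δ A i + δ A j) < clsTy A φ) :
    faceVec₀ A φ i j ψ (φ, ψ) = 1 ∧ ∀ χ, χ ≠ (φ, ψ) → faceVec₀ A φ i j ψ χ ≠ 0 → pot A χ < pot A (φ, ψ) := by
  have hp : pot A (φ, ψ) = clsTy A φ + clsTy A ψ := rfl
  have hp4 : pot A (φ + δ A i + δ A j, ψ) = clsTy A (φ + δ A i + δ A j) + clsTy A ψ := rfl
  unfold faceVec₀
  refine isRed_of_corners A ?_ ?_ ?_
  · rw [pot_bar_corner, hp]; omega
  · rw [pot_bar_corner, hp]; omega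
  · rw [hp4, hp]; omega

/-- **A mixed square whose two single flips lower the classes covers its label.** [folklore] -/
theorem cover_faceVecM {φ ψ : Ty A} {i j : A} (hi : clsTy A (φ + δ A i) < clsTy A φ) (hj : clsTy A (ψ + δ A j) < clsTy A ψ) :
    faceVecM A φ i ψ j (φ, ψ) = 1 ∧ ∀ χ, χ ≠ (φ, ψ) → faceVecM A φ i ψ j χ ≠ 0 → pot A χ < pot A (φ, ψ) := by
  have hp : pot A (φ, ψ) = clsTy A φ + clsTy A ψ := rfl
  have e3 : ψ + 1 + δ A j = ψ + δ A j + 1 := add_right_comm _ _ _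
  have hp3 : pot A (φ + 1, ψ + 1 + δ A j) = clsTy A φ + clsTy A (ψ + δ A j) := by
    rw [e3]; unfold pot; simp only [clsTy_add_one]
  have hp4 : pot A (φ + δ A i, ψ + δ A j) = clsTy A (φ + δ A i) + clsTy A (ψ + δ A j) := rfl
  unfold faceVecM
  refine isRed_of_corners A ?_ ?_ ?_
  · rw [pot_bar_corner, hp]; omega
  · rw [hp3, hp]; omega
  · rw [hp4, hp]; omega

/-! ## §2 The mirror -/

omit [DecidableEq A] in
/-- **Mirror**: a vector covering `x⁻¹·Ψ` has an `x`-translate covering `Ψ`. [folklore] -/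
theorem cover_mirror {v : Ty₂ A → ℤ} {Ψ : Ty₂ A} (hv : v (twXinv A Ψ) = 1 ∧ ∀ χ, χ ≠ twXinv A Ψ → v χ ≠ 0 → pot A χ < pot A (twXinv A Ψ)) :
    translX A v Ψ = 1 ∧ ∀ χ, χ ≠ Ψ → translX A v χ ≠ 0 → pot A χ < pot A Ψ := by
  have h := cover_translX A hv
  rwa [twX_twXinv] at h

omit [Fintype A] [DecidableEq A] in
/-- The label `x⁻¹·(φ, ψ) = (rev ψ + 1, rev φ)`. [folklore] -/
theorem twXinv_mk (φ ψ : Ty A) : twXinv A (φ, ψ) = (rev A ψ + 1, rev A φ) := rfl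

omit [DecidableEq A] in
/-- Classes of the coordinates of `x⁻¹·(φ, ψ)`: `(cls ψ, cls φ)`. [folklore] -/
theorem clsTy_twXinv (φ ψ : Ty A) : clsTy A (twXinv A (φ, ψ)).1 = clsTy A ψ ∧ clsTy A (twXinv A (φ, ψ)).2 = clsTy A φ := by
  refine ⟨?_, ?_⟩ <;> simp only [twXinv, clsTy_add_one, clsTy_rev]

omit [DecidableEq A] in
/-- Weights of the coordinates of `x⁻¹·(φ, ψ)`: `(|A| − wt ψ, wt φ)`. [folklore] -/
theorem wt_twXinv (φ ψ : Ty A) : wt A (twXinv A (φ, ψ)).1 = Fintype.card A - wt A ψ ∧ wt A (twXinv A (φ, ψ)).2 = wt A φ := by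
  refine ⟨?_, ?_⟩ <;> simp only [twXinv, wt_add_one, wt_rev]

/-! ## §3 Strict squares -/

omit [AddCommGroup A] [DecidableEq A] in
/-- Labels of weight `w` with `2w < |A|` resp. `|A| < 2w` share their strict half indicators. [folklore] -/
theorem loI_upI_eq_of_lt_lt {φ χ : Ty A} (hφ : 2 * wt A φ < Fintype.card A) (hχ : 2 * wt A χ < Fintype.card A) :
    loI A χ = loI A φ ∧ upI A χ = upI A φ := by
  rw [(loI_upI_of_lt A hφ).1, (loI_upI_of_lt A hφ).2, (loI_upI_of_lt A hχ).1, (loI_upI_of_lt A hχ).2]; exact ⟨rfl, rfl⟩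

omit [AddCommGroup A] [DecidableEq A] in
/-- The same above the equator. [folklore] -/
theorem loI_upI_eq_of_gt_gt {φ χ : Ty A} (hφ : Fintype.card A < 2 * wt A φ) (hχ : Fintype.card A < 2 * wt A χ) :
    loI A χ = loI A φ ∧ upI A χ = upI A φ := by
  rw [(loI_upI_of_gt A hφ).1, (loI_upI_of_gt A hφ).2, (loI_upI_of_gt A hχ).1, (loI_upI_of_gt A hχ).2]; exact ⟨rfl, rfl⟩

omit [AddCommGroup A] in
/-- **Two reducing places of a label of class `≥ 2` OFF the equator, staying in its strict half.** [folklore] -/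
theorem exists_strict_square {φ : Ty A} (h2 : 2 ≤ clsTy A φ) (hne : 2 * wt A φ ≠ Fintype.card A) :
    ∃ i j : A, i ≠ j ∧ clsTy A (φ + δ A i) < clsTy A φ ∧ clsTy A (φ + δ A j) < clsTy A φ ∧
      clsTy A (φ + δ A i + δ A j) < clsTy A φ ∧
      (loI A (φ + δ A i) = loI A φ ∧ upI A (φ + δ A i) = upI A φ) ∧ (loI A (φ + δ A j) = loI A φ ∧ upI A (φ + δ A j) = upI A φ) ∧
      (loI A (φ + δ A i + δ A j) = loI A φ ∧ upI A (φ + δ A i + δ A j) = upI A φ) := by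
  have hle := clsTy_le A φ
  have hwle := wt_le A φ
  by_cases hlow : 2 * wt A φ < Fintype.card A
  · obtain ⟨i, j, hij, hi, hj⟩ := exists_two_defects A (φ := φ) (by omega)
    have w1 := wt_add_delta_of_apply_eq_one A hi
    have w2 := wt_add_delta_of_apply_eq_one A hj
    have w3 := wt_corner_flip A hi hj hij
    refine ⟨i, j, hij, ?_, ?_, ?_, loI_upI_eq_of_lt_lt A hlow (by omega), loI_upI_eq_of_lt_lt A hlow (by omega),
      loI_upI_eq_of_lt_lt A hlow (by omega)⟩
    · unfold clsTy; omega
    · unfold clsTy; omega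
    · unfold clsTy; omega
  · have hgt : Fintype.card A < 2 * wt A φ := by omega
    have h2' : 2 ≤ wt A (φ + 1) := by rw [wt_add_one]; unfold clsTy at h2; omega
    obtain ⟨i, j, hij, hi, hj⟩ := exists_two_defects A h2'
    have key : ∀ u : ZMod 2, u + 1 = 1 → u = 0 := by decide
    have hi0 : φ i = 0 := key _ (by simpa using hi)
    have hj0 : φ j = 0 := key _ (by simpa using hj)
    have hj0' : (φ + δ A i) j = 0 := by simp [delta_apply, Ne.symm hij, hj0]
    have w1 := wt_add_delta_of_zero A hi0
    have w2 := wt_add_delta_of_zero A hj0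
    have w3 := wt_add_delta_of_zero A hj0'
    rw [w1] at w3
    have hwle' := wt_le A (φ + δ A i + δ A j)
    refine ⟨i, j, hij, ?_, ?_, ?_, loI_upI_eq_of_gt_gt A hgt (by omega), loI_upI_eq_of_gt_gt A hgt (by omega),
      loI_upI_eq_of_gt_gt A hgt (by omega)⟩
    · unfold clsTy; omega
    · unfold clsTy; omega
    · unfold clsTy; omega

omit [AddCommGroup A] [Fintype A] in
/-- Conjugated corners: `(φ + 1 + δ i, ψ + 1) = ((φ + δ i) + 1, ψ + 1)`. [folklore] -/
theorem bar_corner_eq (φ ψ : Ty A) (i : A) : ((φ + 1 + δ A i, ψ + 1) : Ty₂ A) = (φ + δ A i + 1, ψ + 1) := by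
  rw [add_right_comm]

/-- **A `0`-coordinate square staying in the strict half of `φ` is killed by all four functionals**, for every passive `ψ`. [folklore] -/
theorem killed_faceVec₀_strict (φ : Ty A) {i j : A} (ψ : Ty A) (hij : i ≠ j)
    (h1 : loI A (φ + δ A i) = loI A φ ∧ upI A (φ + δ A i) = upI A φ) (h2 : loI A (φ + δ A j) = loI A φ ∧ upI A (φ + δ A j) = upI A φ)
    (h3 : loI A (φ + δ A i + δ A j) = loI A φ ∧ upI A (φ + δ A i + δ A j) = upI A φ) :
    (∀ s, UE A s (faceVec₀ A φ i j ψ) = 0) ∧ (∀ s, UX A s (faceVec₀ A φ i j ψ) = 0) ∧ SE₀ A (faceVec₀ A φ i j ψ) = 0 ∧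
      SE₁ A (faceVec₀ A φ i j ψ) = 0 := by
  have hd : ∀ t : A, dft A t (φ + δ A i + δ A j) = dft A t (φ + δ A i) + dft A t (φ + δ A j) - dft A t φ := fun t => by
    have := dft_square A t hij (φ := φ); omega
  refine ⟨fun s => ?_, fun s => ?_, ?_, ?_⟩
  · rw [UE_apply, dot_faceVec₀, bar_corner_eq, bar_corner_eq, wE_conj, wE_conj]
    unfold wE; simp only [h1.1, h1.2, h2.1, h2.2, h3.1, h3.2]; ring
  · rw [UX_apply, dot_faceVec₀, bar_corner_eq, bar_corner_eq, wX_conj, wX_conj]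
    unfold wX; simp only [h1.1, h1.2, h2.1, h2.2, h3.1, h3.2, hd]; ring
  · rw [SE₀_apply, dot_faceVec₀, bar_corner_eq, bar_corner_eq, wS₀_conj, wS₀_conj]
    unfold wS₀ sgI eqI; simp only [h1.1, h1.2, h2.1, h2.2, h3.1, h3.2]; ring
  · rw [SE₁_apply, dot_faceVec₀, bar_corner_eq, bar_corner_eq, wS₁_conj, wS₁_conj]
    unfold wS₁ sgI eqI; simp only [h1.1, h1.2, h2.1, h2.2, h3.1, h3.2]; ring

/-- **RULE FACE, strict `0`-coordinate square**: through `(φ, ψ)` with `cls φ ≥ 2`, `φ` off the equator, there is a `0`-coordinate square in the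
Hodge lattice covering the label and killed by all four functionals. [folklore] -/
theorem exists_rule_strict₀ {φ : Ty A} (ψ : Ty A) (h2 : 2 ≤ clsTy A φ) (hne : 2 * wt A φ ≠ Fintype.card A) :
    ∃ v : Ty₂ A → ℤ, (∃ i j : A, i ≠ j ∧ v = faceVec₀ A φ i j ψ) ∧ v ∈ hodge₂ A ∧
      (v (φ, ψ) = 1 ∧ ∀ χ, χ ≠ (φ, ψ) → v χ ≠ 0 → pot A χ < pot A (φ, ψ)) ∧
      ((∀ s, UE A s v = 0) ∧ (∀ s, UX A s v = 0) ∧ SE₀ A v = 0 ∧ SE₁ A v = 0) := by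
  obtain ⟨i, j, hij, hi, hj, hij', h1, h2, h3⟩ := exists_strict_square A h2 hne
  exact ⟨faceVec₀ A φ i j ψ, ⟨i, j, hij, rfl⟩, faceVec₀_mem A φ hij ψ, cover_faceVec₀ A ψ hi hj hij',
    killed_faceVec₀_strict A φ ψ hij h1 h2 h3⟩

/-! ## §4 Mixed squares at two labels of class one -/

omit [AddCommGroup A] in
/-- **The reducing place of a label of class `1`, with the strict half of the flip**: the flip is a constant in the same strict half (`|A| ≥ 3`).
[folklore] -/
theorem exists_one_reducing_strict (h3 : 3 ≤ Fintype.card A) {φ : Ty A} (h1 : clsTy A φ = 1) :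
    ∃ s : A, clsTy A (φ + δ A s) = 0 ∧ loI A (φ + δ A s) = loI A φ ∧ upI A (φ + δ A s) = upI A φ ∧
      2 * wt A φ ≠ Fintype.card A ∧ 2 * wt A (φ + δ A s) ≠ Fintype.card A := by
  have hle := clsTy_le A φ
  have hwle := wt_le A φ
  by_cases hlow : wt A φ ≤ Fintype.card A / 2
  · have hw : wt A φ = 1 := by unfold clsTy at h1; omega
    rcases eq_zero_or_eq_delta_of_wt_le_one A (χ := φ) (by omega) with h0 | ⟨s, hs⟩
    · rw [h0, wt_zero] at hw; omega
    · refine ⟨s, ?_, ?_⟩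
      · rw [hs, delta_add_delta]; unfold clsTy; rw [wt_zero]; simp
      · have hw0 : wt A (φ + δ A s) = 0 := by rw [hs, delta_add_delta, wt_zero]
        refine ⟨(loI_upI_eq_of_lt_lt A (φ := φ) (by omega) (by omega)).1, (loI_upI_eq_of_lt_lt A (φ := φ) (by omega) (by omega)).2, by omega,
          by omega⟩
  · have hw : wt A (φ + 1) = 1 := by rw [wt_add_one]; unfold clsTy at h1; omega
    rcases eq_zero_or_eq_delta_of_wt_le_one A (χ := φ + 1) (by omega) with h0 | ⟨s, hs⟩
    · rw [h0, wt_zero] at hw; omega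
    · have hφ : φ + δ A s = 1 := by
        have : φ = δ A s + 1 := by rw [← hs, add_one_add_one]
        rw [this, add_right_comm, delta_add_delta, zero_add]
      have hw1 : wt A (1 : Ty A) = Fintype.card A := by
        have := wt_add_one A (0 : Ty A); rw [zero_add, wt_zero] at this; omega
      have hwφ : wt A φ = Fintype.card A - 1 := by rw [wt_add_one] at hw; omega
      refine ⟨s, ?_, ?_⟩
      · rw [hφ]; unfold clsTy; rw [hw1]; simp
      · rw [hφ, hw1]
        refine ⟨(loI_upI_eq_of_gt_gt A (φ := φ) (by omega) (by rw [hw1]; omega)).1,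
          (loI_upI_eq_of_gt_gt A (φ := φ) (by omega) (by rw [hw1]; omega)).2, by omega, by omega⟩

/-- **A mixed square whose two active flips stay in the strict halves is killed by all four functionals.** [folklore] -/
theorem killed_faceVecM_strict {φ ψ : Ty A} {i j : A} (hφ : loI A (φ + δ A i) = loI A φ ∧ upI A (φ + δ A i) = upI A φ)
    (hψ : loI A (ψ + δ A j) = loI A ψ ∧ upI A (ψ + δ A j) = upI A ψ) (hφne : 2 * wt A φ ≠ Fintype.card A)
    (hψne : 2 * wt A ψ ≠ Fintype.card A) :
    (∀ s, UE A s (faceVecM A φ i ψ j) = 0) ∧ (∀ s, UX A s (faceVecM A φ i ψ j) = 0) ∧ SE₀ A (faceVecM A φ i ψ j) = 0 ∧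
      SE₁ A (faceVecM A φ i ψ j) = 0 := by
  have e2 : ((φ + 1, ψ + 1 + δ A j) : Ty₂ A) = (φ + 1, ψ + δ A j + 1) := by rw [add_right_comm ψ]
  -- off the equator the equator indicators vanish
  have heφ : eqI A φ = 0 := by
    unfold eqI loI upI
    by_cases h : 2 * wt A φ < Fintype.card A
    · rw [if_pos h, if_neg (by omega)]; ring
    · rw [if_neg h, if_pos (by omega)]; ring
  have heψ : eqI A ψ = 0 := by
    unfold eqI loI upI
    by_cases h : 2 * wt A ψ < Fintype.card A
    · rw [if_pos h, if_neg (by omega)]; ring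
    · rw [if_neg h, if_pos (by omega)]; ring
  have heφ' : eqI A (φ + δ A i) = 0 := by unfold eqI; rw [hφ.1, hφ.2]; unfold eqI at heφ; exact heφ
  have heψ' : eqI A (ψ + δ A j) = 0 := by unfold eqI; rw [hψ.1, hψ.2]; unfold eqI at heψ; exact heψ
  refine ⟨fun s => ?_, fun s => ?_, ?_, ?_⟩
  · rw [UE_apply, dot_faceVecM, bar_corner_eq, e2, wE_conj, wE_conj]
    unfold wE; simp only [hφ.1, hφ.2, hψ.1, hψ.2]; ring
  · rw [UX_apply, dot_faceVecM, bar_corner_eq, e2, wX_conj, wX_conj]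
    unfold wX; simp only [hφ.1, hφ.2, hψ.1, hψ.2]; ring
  · rw [SE₀_apply, dot_faceVecM, bar_corner_eq, e2, wS₀_conj, wS₀_conj]
    unfold wS₀ sgI; simp only [hφ.1, hφ.2, hψ.1, hψ.2, heφ, heφ']; ring
  · rw [SE₁_apply, dot_faceVecM, bar_corner_eq, e2, wS₁_conj, wS₁_conj]
    unfold wS₁ sgI; simp only [hφ.1, hφ.2, hψ.1, hψ.2, heψ, heψ']; ring

/-- **RULE FACE, two classes one**: through `(φ, ψ)` with `cls φ = cls ψ = 1` the mixed square at the two reducing places is in the Hodge lattice,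
covers the label and is killed by all four functionals (`|A| ≥ 3`). [folklore] -/
theorem exists_rule_mixed₁₁ (h3 : 3 ≤ Fintype.card A) {φ ψ : Ty A} (hφ : clsTy A φ = 1) (hψ : clsTy A ψ = 1) :
    ∃ v : Ty₂ A → ℤ, (∃ i j : A, v = faceVecM A φ i ψ j) ∧ v ∈ hodge₂ A ∧
      (v (φ, ψ) = 1 ∧ ∀ χ, χ ≠ (φ, ψ) → v χ ≠ 0 → pot A χ < pot A (φ, ψ)) ∧
      ((∀ s, UE A s v = 0) ∧ (∀ s, UX A s v = 0) ∧ SE₀ A v = 0 ∧ SE₁ A v = 0) := by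
  obtain ⟨i, hi, hli, hui, hφne, -⟩ := exists_one_reducing_strict A h3 hφ
  obtain ⟨j, hj, hlj, huj, hψne, -⟩ := exists_one_reducing_strict A h3 hψ
  exact ⟨faceVecM A φ i ψ j, ⟨i, j, rfl⟩, faceVecM_mem A φ i ψ j, cover_faceVecM A (by rw [hi, hφ]; omega) (by rw [hj, hψ]; omega),
    killed_faceVecM_strict A ⟨hli, hui⟩ ⟨hlj, huj⟩ hφne hψne⟩

end Summit.HodgeConjecture.CorCM.Census.DicyclicTwist
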